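import Summits.ValiantsHypothesis.ValiantsHypothesis.Theorems.SymPencilHomogeneousDropRankCodim

/-!
# Route `SymPencil` — Lagrangian kernel rows force affine restrictions
# (core linear algebra of the rung `sdc(per_4) ≥ 18`, `--supports` stmt-ValiantsHypothesis-5674)

Pure linear algebra over a field of characteristic `0`.  Data: an invertible symmetric `D`, linear
families `b : V → K^{ι'}` (kernel rows) and `C : V → Sym_{ι'}`, a function `φ : V → K` and
`κ ≠ 0`, subject to the three ORIGIN MOMENT identities of a symmetric determinantal representation
of a quartic (`SymPencilOriginMoments.moments_four`):

 (i)   `b(z)ᵀ D⁻¹ b(z) = 0`,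
 (ii)  `b(z)ᵀ D⁻¹ C(z) D⁻¹ b(z) = 0`,
 (iii) `det D · b(z)ᵀ D⁻¹ C(z) D⁻¹ C(z) D⁻¹ b(z) = -κ φ(z)`            for all `z`,

and the LAGRANGIAN hypothesis `2 · dim (im b) = |ι'|`.  Conclusion (`affine_of_lagrangian`): for
every `u` and every `x ∈ ker b`, `s ↦ φ (u + s x)` is affine, `φ (u + s x) = e₀ + s e₁`.

Proof.  Polarising (i), `B := im b` is totally `D⁻¹`-isotropic, so `D⁻¹ B ⊆ B^⊥`, with equality by
the Lagrangian dimension count.  From (ii) at `z = u + v`, `v ∈ ker b`: `yᵀ D⁻¹ C(v) D⁻¹ y' = 0` for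
`y, y' ∈ B`, i.e. `D⁻¹ C(v) D⁻¹ y ∈ B^⊥ = D⁻¹ B`, so `C(v) D⁻¹ y ∈ B` is `D⁻¹`-isotropic:
`(C(v) D⁻¹ y)ᵀ D⁻¹ (C(v) D⁻¹ y) = 0`.  This is exactly the `s²`-coefficient of the right-hand
side of (iii) at `z = u + s x`. [folklore]
-/

noncomputable section

-- single-conjunct layout: Sub = Summit, duplicated namespace component intended
set_option linter.dupNamespace false

namespace Summit.ValiantsHypothesis.ValiantsHypothesis.Theorems.SymPencilLagrangianKernel

open Matrix

universe u

variable {k : Type u} [Field k] {ι' : Type*} [Fintype ι'] [DecidableEq ι']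

omit [DecidableEq ι'] in
/-- Moving a symmetric matrix across a dot product: `x ⬝ P (q) = (P x) ⬝ q`. [folklore] -/
theorem dotProduct_mulVec_of_transpose_eq {P : Matrix ι' ι' k} (hP : Pᵀ = P) (x q : ι' → k) :
    x ⬝ᵥ P *ᵥ q = (P *ᵥ x) ⬝ᵥ q := by
  rw [Matrix.dotProduct_mulVec, ← Matrix.mulVec_transpose, hP]

omit [DecidableEq ι'] in
/-- The triple sandwich `yᵀ (D⁻¹ C D⁻¹ C D⁻¹) y = wᵀ D⁻¹ w` with `w = C D⁻¹ y`, for symmetric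
`D⁻¹, C`. [folklore] -/
theorem sandwich_eq {Di Cm : Matrix ι' ι' k} (hDi : Diᵀ = Di) (hC : Cmᵀ = Cm) (y : ι' → k) :
    y ⬝ᵥ (Di * Cm * Di * Cm * Di) *ᵥ y = (Cm *ᵥ (Di *ᵥ y)) ⬝ᵥ Di *ᵥ (Cm *ᵥ (Di *ᵥ y)) := by
  simp only [← Matrix.mulVec_mulVec]
  rw [dotProduct_mulVec_of_transpose_eq hDi, dotProduct_mulVec_of_transpose_eq hC]

omit [DecidableEq ι'] in
/-- The double sandwich `yᵀ (D⁻¹ C D⁻¹) y' = (D⁻¹ y) ⬝ C (D⁻¹ y')`. [folklore] -/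
theorem sandwich₂_eq {Di Cm : Matrix ι' ι' k} (hDi : Diᵀ = Di) (y y' : ι' → k) :
    y ⬝ᵥ (Di * Cm * Di) *ᵥ y' = (Di *ᵥ y) ⬝ᵥ Cm *ᵥ (Di *ᵥ y') := by
  simp only [← Matrix.mulVec_mulVec]
  rw [dotProduct_mulVec_of_transpose_eq hDi]

variable [CharZero k] {V : Type*} [AddCommGroup V] [Module k V]

/-- **Lagrangian kernel rows force affine restrictions.** See the module docstring. [folklore] -/
theorem affine_of_lagrangian {D : Matrix ι' ι' k} (hD : IsUnit D.det) (hDs : Dᵀ = D)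
    (b : V →ₗ[k] (ι' → k)) (C : V →ₗ[k] Matrix ι' ι' k) (hCs : ∀ z, (C z)ᵀ = C z)
    (φ : V → k) {κ : k} (hκ : κ ≠ 0)
    (hi : ∀ z, b z ⬝ᵥ D⁻¹ *ᵥ b z = 0)
    (hii : ∀ z, b z ⬝ᵥ (D⁻¹ * C z * D⁻¹) *ᵥ b z = 0)
    (hiii : ∀ z, D.det * (b z ⬝ᵥ (D⁻¹ * C z * D⁻¹ * C z * D⁻¹) *ᵥ b z) = -(κ * φ z))
    (hL : 2 * Module.finrank k (LinearMap.range b) = Fintype.card ι')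
    (u x : V) (hx : b x = 0) : ∃ e₀ e₁ : k, ∀ s : k, φ (u + s • x) = e₀ + s * e₁ := by
  have hDis : (D⁻¹)ᵀ = D⁻¹ := by rw [Matrix.transpose_nonsing_inv, hDs]
  set B := LinearMap.range b with hBdef
  -- (1) polarised isotropy on `B`
  have hsymm0 : ∀ y y' : ι' → k, y ⬝ᵥ D⁻¹ *ᵥ y' = y' ⬝ᵥ D⁻¹ *ᵥ y := fun y y' => by
    rw [dotProduct_mulVec_of_transpose_eq hDis, dotProduct_comm]
  have hpol : ∀ y ∈ B, ∀ y' ∈ B, y ⬝ᵥ D⁻¹ *ᵥ y' = 0 := by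
    rintro _ ⟨z, rfl⟩ _ ⟨z', rfl⟩
    have h := hi (z + z')
    rw [map_add, Matrix.mulVec_add, dotProduct_add, add_dotProduct, add_dotProduct, hi z, hi z',
      hsymm0 (b z') (b z), zero_add, add_zero, ← two_mul] at h
    exact (mul_eq_zero.1 h).resolve_left two_ne_zero
  -- (2) first moment along the kernel: `yᵀ D⁻¹ C(v) D⁻¹ y = 0` for `y ∈ B`, `b v = 0`
  have hker1 : ∀ z v, b v = 0 → (D⁻¹ *ᵥ b z) ⬝ᵥ C v *ᵥ (D⁻¹ *ᵥ b z) = 0 := by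
    intro z v hv
    have h1 := hii (z + v)
    have h0 := hii z
    rw [map_add, hv, add_zero, map_add, sandwich₂_eq hDis, Matrix.add_mulVec, dotProduct_add] at h1
    rw [sandwich₂_eq hDis] at h0
    rwa [h0, zero_add] at h1
  -- polarised in `y`
  have hsymm1 : ∀ v (p q : ι' → k), p ⬝ᵥ C v *ᵥ q = q ⬝ᵥ C v *ᵥ p := fun v p q => by
    rw [dotProduct_mulVec_of_transpose_eq (hCs v), dotProduct_comm]
  have hker2 : ∀ y ∈ B, ∀ y' ∈ B, ∀ v, b v = 0 → (D⁻¹ *ᵥ y) ⬝ᵥ C v *ᵥ (D⁻¹ *ᵥ y') = 0 := by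
    rintro _ ⟨z, rfl⟩ _ ⟨z', rfl⟩ v hv
    have h := hker1 (z + z') v hv
    rw [map_add, Matrix.mulVec_add, Matrix.mulVec_add, dotProduct_add, add_dotProduct,
      add_dotProduct, hker1 z v hv, hker1 z' v hv, hsymm1 v (D⁻¹ *ᵥ b z') (D⁻¹ *ᵥ b z), zero_add,
      add_zero, ← two_mul] at h
    exact (mul_eq_zero.1 h).resolve_left two_ne_zero
  -- (3) the Lagrangian count: `B^⊥ = D⁻¹ B`
  have hperp : ∀ q : ι' → k, (∀ y ∈ B, y ⬝ᵥ q = 0) → ∃ y' ∈ B, q = D⁻¹ *ᵥ y' := by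
    -- a basis of `B` and the pairing map
    let yB := Module.finBasis k B
    set r := Module.finrank k B with hr
    let Y : Matrix (Fin r) ι' k := Matrix.of fun i j => (yB i : ι' → k) j
    have hYrow : ∀ i, Y i = (yB i : ι' → k) := fun i => rfl
    -- `ker Y ⊇ D⁻¹ B`
    let B' : Submodule k (ι' → k) := Submodule.map (D⁻¹).mulVecLin B
    have hB'le : B' ≤ LinearMap.ker Y.mulVecLin := by
      rintro _ ⟨y', hy', rfl⟩
      rw [LinearMap.mem_ker, Matrix.mulVecLin_apply]
      ext i
      rw [Pi.zero_apply, Matrix.mulVec, hYrow, Matrix.mulVecLin_apply]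
      exact hpol _ (yB i).2 _ hy'
    -- dimensions
    have hDiu : IsUnit D⁻¹ :=
      (Matrix.isUnit_iff_isUnit_det _).2 (Matrix.isUnit_nonsing_inv_det_iff.2 hD)
    have hinj : Function.Injective (D⁻¹).mulVecLin := Matrix.mulVec_injective_iff_isUnit.2 hDiu
    have hB'dim : Module.finrank k B' = r :=
      (Submodule.equivMapOfInjective _ hinj B).finrank_eq.symm
    have hYrank : Y.rank = r := by
      rw [Matrix.rank_eq_finrank_span_row]
      have hrange : Set.range Y.row = B.subtype '' Set.range yB := by
        ext q
        simp only [Set.mem_range, Set.mem_image, Submodule.coe_subtype, Matrix.row, hYrow]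
        constructor
        · rintro ⟨i, rfl⟩; exact ⟨yB i, ⟨i, rfl⟩, rfl⟩
        · rintro ⟨_, ⟨i, rfl⟩, rfl⟩; exact ⟨i, rfl⟩
      rw [hrange, Submodule.span_image, yB.span_eq, Submodule.map_top, Submodule.range_subtype]
    have hkerdim : Module.finrank k (LinearMap.ker Y.mulVecLin) = r := by
      have h := LinearMap.finrank_range_add_finrank_ker Y.mulVecLin
      rw [Module.finrank_fintype_fun_eq_card] at h
      change Y.rank + _ = _ at h
      omega
    have hB'eq : B' = LinearMap.ker Y.mulVecLin :=
      Submodule.eq_of_le_of_finrank_eq hB'le (by rw [hB'dim, hkerdim])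
    -- conclude
    intro q hq
    have hqker : q ∈ LinearMap.ker Y.mulVecLin := by
      rw [LinearMap.mem_ker, Matrix.mulVecLin_apply]
      ext i
      rw [Matrix.mulVec, hYrow, Pi.zero_apply]
      exact hq _ (yB i).2
    rw [← hB'eq] at hqker
    obtain ⟨y', hy', hq'⟩ := hqker
    exact ⟨y', hy', by rw [← hq']; rfl⟩
  -- (4) `C(v) D⁻¹ y ∈ B`, hence `D⁻¹`-isotropic
  have hIV : ∀ y ∈ B, ∀ v, b v = 0 →
      (C v *ᵥ (D⁻¹ *ᵥ y)) ⬝ᵥ D⁻¹ *ᵥ (C v *ᵥ (D⁻¹ *ᵥ y)) = 0 := by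
    intro y hy v hv
    set w := C v *ᵥ (D⁻¹ *ᵥ y) with hw
    -- `D⁻¹ w ∈ B^⊥`
    have h1 : ∀ y' ∈ B, y' ⬝ᵥ (D⁻¹ *ᵥ w) = 0 := by
      intro y' hy'
      rw [dotProduct_mulVec_of_transpose_eq hDis, hw, hsymm1]
      exact hker2 y hy y' hy' v hv
    obtain ⟨y'', hy'', hq⟩ := hperp (D⁻¹ *ᵥ w) h1
    have hwB : w = y'' := by
      have := congr_arg (fun q => D *ᵥ q) hq
      simp only [Matrix.mulVec_mulVec, Matrix.mul_nonsing_inv _ hD, Matrix.one_mulVec] at this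
      exact this
    rw [hwB]
    exact hpol _ hy'' _ hy''
  -- (5) expand (iii) at `z = u + s x`
  set y := b u with hy
  have hyB : y ∈ B := ⟨u, rfl⟩
  set wu := C u *ᵥ (D⁻¹ *ᵥ y) with hwu
  set wx := C x *ᵥ (D⁻¹ *ᵥ y) with hwx
  refine ⟨-(D.det * (wu ⬝ᵥ D⁻¹ *ᵥ wu)) / κ, -(D.det * (wu ⬝ᵥ D⁻¹ *ᵥ wx + wx ⬝ᵥ D⁻¹ *ᵥ wu)) / κ,
    fun s => ?_⟩
  have h := hiii (u + s • x)
  have hbz : b (u + s • x) = y := by rw [map_add, map_smul, hx, smul_zero, add_zero]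
  rw [hbz, sandwich_eq hDis (hCs _), map_add, map_smul, Matrix.add_mulVec, Matrix.smul_mulVec,
    ← hwu, ← hwx, Matrix.mulVec_add, Matrix.mulVec_smul, dotProduct_add, add_dotProduct,
    add_dotProduct, dotProduct_smul, smul_dotProduct, smul_dotProduct, dotProduct_smul,
    hIV y hyB x hx] at h
  simp only [smul_eq_mul, mul_zero] at h
  field_simp
  linear_combination h

end Summit.ValiantsHypothesis.ValiantsHypothesis.Theorems.SymPencilLagrangianKernel

end
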